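import Summits.Parity.BatemanHorn.Theses.RoughValueTransport
import Summits.Parity.BatemanHorn.Theorems.BalancedSemiprimeLayer.Negative.LowerHalf
import Literature.NumberTheory.Sieve.BuchstabLimitFact
import Literature.NumberTheory.Sieve.BatemanHornProofs
import HarnessLib

/-!
# Route `RoughValueTransport`, assembly item `Assembly` (stmt-Parity-11392)

We PROVE `Summit.Parity.BatemanHorn.Theses.RoughValueTransport.Assembly`
(`roughValueTransportAssembly_proof`):
`RoughValueLaw → BalancedSemiprimeLayer → SieveCalibration → BatemanHorn`, the two-sided squeeze of
the route thesis, system by system.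

Fix a Bateman–Horn system `f = (f₁, …, f_k)` and put `D = ∏ deg fᵢ > 0`
(`IsBatemanHornSystem.natDegree_pos`), `C₀ = C(f)/D` with `C(f) = batemanHornConst f > 0`
(`IsBatemanHornSystem.hasBatemanHornConst_holds`), and
`Φ_f(x, u) = #{1 ≤ n ≤ x : ∀ i, fᵢ(n) > 0 and no prime p < x^{deg fᵢ/u} divides fᵢ(n)}`.

1. `RoughValueLaw` at `ω := buchstabOmega` (it satisfies the inline predicate by
   `buchstabOmega_eq_inv`, `continuousOn_buchstabOmega`, `hasDerivAt_mul_buchstabOmega`) gives `A`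
   with `Φ_f(x,u)(log x)^k/x → A(uω(u))^k` for every `u > 2`.
2. `SieveCalibration` with `L(u) = A(uω(u))^k` gives `Aω(u)^k → C₀e^{−kγ}`; the PROVED de Bruijn
   limit `harman2007_buchstabOmega_tendsto_holds` gives `Aω(u)^k → Ae^{−kγ}`; so `A = C₀`.
3. At `u = 2/(1−δ)`, `0 < δ ≤ 1/4`, the count with exponents `deg fᵢ(1−δ)/2` IS `Φ_f(x,u)` and
   `(uω(u))^k = (1 + log((1+δ)/(1−δ)))^k ≥ 1` (`buchstabOmega_eq_of_mem_Icc_two_three`).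
4. Lower bound: `BalancedSemiprimeLayer` (`Φ_f ≤ P_f + εx/(log x)^k` eventually) gives
   `liminf P_f(x)(log x)^k/x ≥ C₀ − ε`.
5. Upper bound: the PROVED `BalancedSemiprimeLayer.Negative.polyPrimeCount_le_cruxCount_add`
   (`P_f ≤ Φ_f(x,δ) + K + k(2√x + 1)`, an `n` with all `fᵢ(n)` prime is jointly rough unless a prime
   value lies below its sifting range, which forces `n ≪ √x`) and
   `(K + k(2√x+1))(log x)^k/x → 0` (`RoughValueTransportAssembly.tendsto_remainder`) give
   `limsup ≤ C₀(1 + log((1+δ)/(1−δ)))^k`, which is `< b` for any `b > C₀` once `δ` is small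
   (continuity at `δ = 0`).
6. Hence `P_f(x)(log x)^k/x → C₀`, i.e. `P_f(x) ~ C₀·x/(log x)^k` (`isEquivalent_iff_tendsto_one`),
   which with `HasBatemanHornConst f (batemanHornConst f)` is `BatemanHornAsymptotic f`; over all
   `(k, f)` this is `Literature.NumberTheory.Sieve.BatemanHornConjecture = _root_.BatemanHorn`.

References: P. T. Bateman, R. A. Horn, Math. Comp. 16 (1962), (1); G. Harman, *Prime-Detecting
Sieves* (2007), §1.4 (Buchstab's function, (1.4.16)).
-/

noncomputable section

open Filter Finset Polynomial Real Asymptotics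
open scoped Topology BigOperators
open Literature.NumberTheory.Sieve
open Summit.Parity.BatemanHorn.Theses.RoughValueTransport

namespace Summit.Parity.BatemanHorn.Theorems

/-- The remainder of the upper half of the squeeze is negligible:
`(K + k(2√x + 1))·(log x)^k/x → 0` along `ℕ` (`(log x)^k = o(x)` and `(log x)^k = o(√x)`).
[folklore] -/
theorem RoughValueTransportAssembly.tendsto_remainder (K : ℝ) (k : ℕ) :
    Tendsto (fun x : ℕ => (K + k * (2 * Real.sqrt x + 1)) * Real.log x ^ k / x) atTop (𝓝 0) := by
  -- `(log x)^k / x → 0`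
  have h1 : Tendsto (fun x : ℕ => Real.log x ^ k / (x : ℝ)) atTop (𝓝 0) :=
    (isLittleO_pow_log_id_atTop (n := k)).tendsto_div_nhds_zero.comp tendsto_natCast_atTop_atTop
  -- `√x (log x)^k / x → 0`
  have h2 : Tendsto (fun x : ℕ => Real.sqrt x * Real.log x ^ k / (x : ℝ)) atTop (𝓝 0) := by
    have h := (isLittleO_log_rpow_rpow_atTop (k : ℝ) (by norm_num : (0 : ℝ) < 1 / 2))
      |>.tendsto_div_nhds_zero.comp tendsto_natCast_atTop_atTop
    refine h.congr' ?_
    filter_upwards [eventually_gt_atTop 0] with x hx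
    have hx0 : (0 : ℝ) < x := Nat.cast_pos.mpr hx
    have hs : 0 < Real.sqrt x := Real.sqrt_pos.mpr hx0
    simp only [Function.comp_apply]
    rw [Real.rpow_natCast, ← Real.sqrt_eq_rpow, div_eq_div_iff hs.ne' hx0.ne']
    calc Real.log x ^ k * x = Real.log x ^ k * (Real.sqrt x * Real.sqrt x) := by
          rw [Real.mul_self_sqrt hx0.le]
      _ = Real.sqrt x * Real.log x ^ k * Real.sqrt x := by ring
  have h3 : Tendsto (fun x : ℕ => K * (Real.log x ^ k / (x : ℝ)) +
      k * (2 * (Real.sqrt x * Real.log x ^ k / (x : ℝ)) + Real.log x ^ k / (x : ℝ))) atTop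
      (𝓝 0) := by
    have := (h1.const_mul K).add (((h2.const_mul 2).add h1).const_mul (k : ℝ))
    simpa using this
  refine h3.congr' (Eventually.of_forall fun x => ?_)
  ring

/-- **`Assembly` (item stmt-Parity-11392 of route `RoughValueTransport`).**
`RoughValueLaw → BalancedSemiprimeLayer → SieveCalibration → BatemanHorn`: for every Bateman–Horn
system, the rough-value shape (instantiated at Buchstab's `ω = buchstabOmega`), with its constant
pinned to `C(f)/∏ deg fᵢ` by `SieveCalibration` and de Bruijn's limit `ω(u) → e^{−γ}`, squeezes
`P_f(x)(log x)^k/x → C(f)/∏ deg fᵢ` between the boundary layer (`BalancedSemiprimeLayer`, from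
below) and the elementary inclusion "all values prime ⇒ jointly rough up to `O(√x)`" (from above),
at depths `u = 2/(1−δ) ↓ 2` where `(uω(u))^k = (1 + log(u−1))^k → 1`. [folklore] -/
theorem roughValueTransportAssembly_proof :
    Summit.Parity.BatemanHorn.Theses.RoughValueTransport.Assembly := by
  unfold Summit.Parity.BatemanHorn.Theses.RoughValueTransport.Assembly
  intro hR hL hS k f hf
  -- the constants `D = ∏ deg fᵢ > 0`, `C(f) > 0`, `C₀ = C(f)/D`
  have hD0 : (0 : ℝ) < ∏ i, ((f i).natDegree : ℝ) :=
    prod_pos fun i _ => by exact_mod_cast hf.natDegree_pos i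
  obtain ⟨hconst, hCf0⟩ := IsBatemanHornSystem.hasBatemanHornConst_holds hf
  obtain ⟨C₀, hC₀_def⟩ : ∃ C₀ : ℝ, C₀ = batemanHornConst f / ∏ i, ((f i).natDegree : ℝ) :=
    ⟨_, rfl⟩
  have hC₀0 : 0 < C₀ := by rw [hC₀_def]; exact div_pos hCf0 hD0
  -- Step 1: `ω = buchstabOmega` satisfies the inline predicate; `A` from `RoughValueLaw`
  obtain ⟨A, hA⟩ := hR k f hf buchstabOmega
    ⟨fun u h1 h2 => buchstabOmega_eq_inv h1 h2, continuousOn_buchstabOmega,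
      fun u hu => hasDerivAt_mul_buchstabOmega hu⟩
  -- Step 2: `SieveCalibration` with `L u = A (u ω u)^k` and de Bruijn's limit pin `A = C₀`
  have hSC := hS k f hf (fun u => A * (u * buchstabOmega u) ^ k)
    ⟨3, fun u hu => hA u (by linarith)⟩
  rw [← hC₀_def] at hSC
  have hω := harman2007_buchstabOmega_tendsto_holds
  unfold harman2007_buchstabOmega_tendsto at hω
  have hSC' : Tendsto (fun u : ℝ => A * (u * buchstabOmega u) ^ k / u ^ k) atTop
      (𝓝 (A * Real.exp (-Real.eulerMascheroniConstant) ^ k)) := by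
    have h1 := (hω.pow k).const_mul A
    refine h1.congr' ?_
    filter_upwards [eventually_gt_atTop 0] with u hu
    rw [mul_pow]
    field_simp
  have hAeq : A = C₀ := by
    have huniq := tendsto_nhds_unique hSC' hSC
    have he : Real.exp (-((k : ℝ) * Real.eulerMascheroniConstant)) =
        Real.exp (-Real.eulerMascheroniConstant) ^ k := by
      rw [← Real.exp_nat_mul]
      congr 1
      ring
    rw [he] at huniq
    exact mul_right_cancel₀ (pow_ne_zero k (Real.exp_pos _).ne') huniq
  -- Step 3: at `u = 2/(1−δ)` the count sifted to `x^{deg fᵢ(1−δ)/2}` is `Φ_f(x,u)`, with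
  -- normalised limit `C₀ (1 + log((1+δ)/(1−δ)))^k`
  have hdepth : ∀ δ : ℝ, 0 < δ → δ ≤ 1 / 4 →
      Tendsto (fun x : ℕ => (#((Icc 1 x).filter (fun n : ℕ => ∀ i, 0 < (f i).eval (n : ℤ) ∧
        ∀ p ∈ range ⌈(x : ℝ) ^ (((f i).natDegree : ℝ) * (1 - δ) / 2)⌉₊,
          p.Prime → ¬ ((p : ℤ) ∣ (f i).eval (n : ℤ)))) : ℝ) * Real.log x ^ k / x) atTop
        (𝓝 (C₀ * (1 + Real.log ((1 + δ) / (1 - δ))) ^ k)) := by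
    intro δ hδ0 hδ4
    obtain ⟨u, hu_def⟩ : ∃ u : ℝ, u = 2 / (1 - δ) := ⟨_, rfl⟩
    have h1δ : 0 < 1 - δ := by linarith
    have hu2 : 2 < u := by
      rw [hu_def, lt_div_iff₀ h1δ]; linarith
    have hu3 : u ≤ 3 := by
      rw [hu_def, div_le_iff₀ h1δ]; linarith
    have hexp : ∀ d : ℕ, (d : ℝ) / u = (d : ℝ) * (1 - δ) / 2 := by
      intro d
      rw [hu_def]
      field_simp
    have hcount : ∀ x : ℕ, #((Icc 1 x).filter (fun n : ℕ => ∀ i, 0 < (f i).eval (n : ℤ) ∧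
        ∀ p ∈ range ⌈(x : ℝ) ^ (((f i).natDegree : ℝ) / u)⌉₊,
          p.Prime → ¬ ((p : ℤ) ∣ (f i).eval (n : ℤ)))) =
      #((Icc 1 x).filter (fun n : ℕ => ∀ i, 0 < (f i).eval (n : ℤ) ∧
        ∀ p ∈ range ⌈(x : ℝ) ^ (((f i).natDegree : ℝ) * (1 - δ) / 2)⌉₊,
          p.Prime → ¬ ((p : ℤ) ∣ (f i).eval (n : ℤ)))) := by
      intro x
      congr 1
      ext n
      simp only [mem_filter, hexp]
    have hval : A * (u * buchstabOmega u) ^ k =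
        C₀ * (1 + Real.log ((1 + δ) / (1 - δ))) ^ k := by
      rw [hAeq, buchstabOmega_eq_of_mem_Icc_two_three hu2.le hu3]
      have hu0 : u ≠ 0 := by linarith
      have h1 : u - 1 = (1 + δ) / (1 - δ) := by
        rw [hu_def]
        field_simp
        ring
      rw [mul_div_cancel₀ _ hu0, h1]
    rw [← hval]
    refine (hA u hu2).congr' (Eventually.of_forall fun x => ?_)
    rw [hcount x]
  -- Step 4–5: the squeeze `P_f(x)(log x)^k/x → C₀`
  have hP : Tendsto (fun x : ℕ => (polyPrimeCount f x : ℝ) * Real.log x ^ k / x) atTop (𝓝 C₀) := by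
    rw [tendsto_order]
    constructor
    · -- lower bound, from `BalancedSemiprimeLayer`
      intro a ha
      obtain ⟨δ, hδ0, hδ4, hev⟩ := hL k f hf ((C₀ - a) / 2) (by linarith)
      have hlim := hdepth δ hδ0 hδ4
      have hV : C₀ ≤ C₀ * (1 + Real.log ((1 + δ) / (1 - δ))) ^ k := by
        have hlog : 0 ≤ Real.log ((1 + δ) / (1 - δ)) := by
          apply Real.log_nonneg
          rw [le_div_iff₀ (by linarith)]
          linarith
        have h1 : (1 : ℝ) ≤ (1 + Real.log ((1 + δ) / (1 - δ))) ^ k := one_le_pow₀ (by linarith)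
        nlinarith
      filter_upwards [hlim.eventually (eventually_gt_nhds (show C₀ - (C₀ - a) / 2 <
          C₀ * (1 + Real.log ((1 + δ) / (1 - δ))) ^ k by linarith)), hev,
        eventually_gt_atTop 1] with x hx hxev hx1
      have hx' : (1 : ℝ) < x := by exact_mod_cast hx1
      have hlog : 0 < Real.log x := Real.log_pos hx'
      have hx0 : (0 : ℝ) < x := by linarith
      have hpow : 0 < Real.log x ^ k := pow_pos hlog k
      have hx0' : (x : ℝ) ≠ 0 := hx0.ne'
      have hpow' : Real.log x ^ k ≠ 0 := hpow.ne'
      have key : ∀ Φ P ε : ℝ, Φ ≤ P + ε * x / Real.log x ^ k →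
          Φ * Real.log x ^ k / x ≤ P * Real.log x ^ k / x + ε := by
        intro Φ P ε h
        have h1 : Φ * Real.log x ^ k / x ≤ (P + ε * x / Real.log x ^ k) * Real.log x ^ k / x :=
          div_le_div_of_nonneg_right (mul_le_mul_of_nonneg_right h hpow.le) hx0.le
        have h2 : (P + ε * x / Real.log x ^ k) * Real.log x ^ k / x =
            P * Real.log x ^ k / x + ε := by
          field_simp
        linarith
      have := key _ _ _ hxev
      linarith
    · -- upper bound, from `polyPrimeCount_le_cruxCount_add` and continuity in `δ` at `0`
      intro b hb
      have hφc : ContinuousAt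
          (fun δ : ℝ => C₀ * (1 + Real.log ((1 + δ) / (1 - δ))) ^ k) 0 := by
        fun_prop (disch := norm_num)
      have hevφ : ∀ᶠ δ : ℝ in 𝓝 0, C₀ * (1 + Real.log ((1 + δ) / (1 - δ))) ^ k < b := by
        have := hφc.tendsto
        simp only [add_zero, sub_zero, div_one, Real.log_one, one_pow, mul_one] at this
        exact this.eventually (eventually_lt_nhds hb)
      obtain ⟨r, hr, hrφ⟩ := Metric.eventually_nhds_iff.mp hevφ
      obtain ⟨δ, hδ_def⟩ : ∃ δ : ℝ, δ = min (1 / 4) (r / 2) := ⟨_, rfl⟩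
      have hδ0 : 0 < δ := by rw [hδ_def]; positivity
      have hδ4 : δ ≤ 1 / 4 := by rw [hδ_def]; exact min_le_left _ _
      have hδr : δ < r := by
        rw [hδ_def]; exact lt_of_le_of_lt (min_le_right _ _) (by linarith)
      have hφδ : C₀ * (1 + Real.log ((1 + δ) / (1 - δ))) ^ k < b :=
        hrφ (by rw [Real.dist_eq, sub_zero, abs_of_pos hδ0]; exact hδr)
      have hlim := hdepth δ hδ0 hδ4
      obtain ⟨K, hK⟩ :=
        BalancedSemiprimeLayer.Negative.polyPrimeCount_le_cruxCount_add
          f hf.leadingCoeff_pos hf.natDegree_pos hδ0.le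
      have hrem := RoughValueTransportAssembly.tendsto_remainder K k
      have hsum := hlim.add hrem
      rw [add_zero] at hsum
      filter_upwards [hsum.eventually (eventually_lt_nhds hφδ), eventually_gt_atTop 1]
        with x hx hx1
      have hx' : (1 : ℝ) < x := by exact_mod_cast hx1
      have hlog : 0 < Real.log x := Real.log_pos hx'
      have hx0 : (0 : ℝ) < x := by linarith
      have hpow : 0 < Real.log x ^ k := pow_pos hlog k
      have key : ∀ P Φ R : ℝ, P ≤ Φ + K + R →
          P * Real.log x ^ k / x ≤ Φ * Real.log x ^ k / x + (K + R) * Real.log x ^ k / x := by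
        intro P Φ R h
        have h1 : P * Real.log x ^ k / x ≤ (Φ + K + R) * Real.log x ^ k / x :=
          div_le_div_of_nonneg_right (mul_le_mul_of_nonneg_right h hpow.le) hx0.le
        have h2 : (Φ + K + R) * Real.log x ^ k / x =
            Φ * Real.log x ^ k / x + (K + R) * Real.log x ^ k / x := by ring
        linarith
      exact lt_of_le_of_lt (key _ _ _ (hK x)) hx
  -- Step 6: `P_f ~ C₀·x/(log x)^k` with the constant `C(f) = batemanHornConst f`
  refine ⟨batemanHornConst f, hconst, ?_⟩
  rw [Fintype.card_fin, ← hC₀_def]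
  have hv : ∀ᶠ x : ℕ in atTop, C₀ * (x : ℝ) / Real.log x ^ k ≠ 0 := by
    filter_upwards [eventually_gt_atTop 1] with x hx
    have hx' : (1 : ℝ) < x := by exact_mod_cast hx
    have : 0 < Real.log x := Real.log_pos hx'
    positivity
  refine (isEquivalent_iff_tendsto_one hv).mpr ?_
  have h2 := hP.div_const C₀
  rw [div_self hC₀0.ne'] at h2
  refine h2.congr' ?_
  filter_upwards [eventually_gt_atTop 1] with x hx
  have hx' : (1 : ℝ) < x := by exact_mod_cast hx
  have hlog : 0 < Real.log x := Real.log_pos hx'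
  have hx0 : (0 : ℝ) < x := by linarith
  have hC₀' : C₀ ≠ 0 := hC₀0.ne'
  simp only [Pi.div_apply]
  field_simp

end Summit.Parity.BatemanHorn.Theorems

end
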